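import Literature.Barriers.PneNP.LowDegreeCounterexamplesCodes64
import Literature.InformationTheory.Coding.OnePointAGCodesDual
import HarnessLib

/-!
# Barrier catalogue `PneNP`, Holmgren–Wein 2021 Prop. 3: Guruswami's `𝔽₆₄`-codes reduced to the
Garcia–Stichtenoth tower (Shpilka 2009, App. A, proof of Thm. 24 — Lemma 22 proved)

`Literature/Barriers/PneNP/LowDegreeCounterexamplesCodes64.lean` reduces Holmgren–Wein's Prop. 3
(`DecodableDualDistanceCodes`, the open leaf below the barrier fact `LowDegreeCounterexamples`,
Holmgren–Wein 2021, Thm. 2) to the data of Thm. 24 of the appendix (by V. Guruswami) of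
[Shpilka 2009] at `r = 8`: `DecodableDualDistanceCodes.of_codes64` takes `𝔽₆₄`-linear codes of
length `N_i = 7·8^{i+2}` whose nonzero dual words have weight `≥ N_i/3` and nonzero codewords weight
`≥ (1/2 - 1/7)N_i`, together with polynomial-time bounded-distance decoding of their binary images
from a fraction `1/60` of errors, as HYPOTHESES (formerly bundled as the named fact
`GuruswamiCodes64`, a decomposition child merged back under D-0026 review, 2026-08-15: its
unformalised content was exactly the parent's). The printed proof of Thm. 24 (p. 25, held:
`lit read doi:10.1007/s00037-009-0281-5`) has three inputs:

1. the Garcia–Stichtenoth tower [GS96]: for every `m ≥ 1` a function field `F_m/𝔽_{r²}` "with at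
   least `n_m + 1 = (r² - r)r^m + 1` rational places, including a fully ramified place `P_∞`",
   whose genus "is at most `r^{m+1}`" (= [Stichtenoth 2009, §7.4]: Lemma 7.4.3 — the pole of `x₀`
   is totally ramified and `[G_{i+1} : G_i] = ℓ`; Lemma 7.4.4 — the `ℓ² - ℓ` places `x₀ = α`,
   `α ∈ 𝔽_{ℓ²} ∖ 𝔽_ℓ`, split completely; Lemma 7.4.5–7.4.6 — the ramification locus lies over
   `𝔽_ℓ ∪ {∞}` with different exponents `d(Q|P) = 2e(Q|P) - 2`; with the Hurwitz genus formula,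
   Thm. 3.4.13, this gives `g(G_m) ≤ ℓ^{m+1} - ℓ`; the exact genus is deferred, Remark 7.4.10);
2. **Lemma 22** (p. 24, "well-known"; = [Stichtenoth 2009, Thm. 2.2.2, Cor. 2.2.3, Thm. 2.2.7–8]):
   `C(D, αQ)` is an `[n, k, d]`-code with `k = α - g + 1` (`α > 2g - 2`), `d ≥ n - α`, and dual
   distance `≥ α - (2g - 2)`; applied with `α_m = n_m/2 + g - 1`: dimension `n_m/2`, distance
   `> (1/2 - g/n_m) n_m`, dual distance `> n_m/2 - g`;
3. the algorithmic half: [SAK+01] ("an algorithm to compute in time polynomial in `n_m, ℓ`, a basis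
   of `L(ℓP_∞)` together with evaluations ... at the rational places") and **Thm. 23** (p. 24, a
   Welch–Berlekamp-type unique decoder up to `⌊(d* - g - 1)/2⌋` errors), giving "deterministic
   polynomial time decoding from a fraction `1/10` of errors", and `1/60` for the binary image
   (Lemma 26, p. 26).

**What this file does.** Input 2 is a THEOREM of the tree, in the abstract setting of one-point
data (`Literature/InformationTheory/Coding/OnePointAGCodes.lean`, `OnePointAGCodesDual.lean`: a
pole-order function at a rational place `Q`, evaluation at `n` rational places, `L(aQ)`,
Weierstrass gaps, `genus = #gaps`; `OnePointData.finrank_code_add_genus`,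
`card_le_add_hammingNorm`, `add_two_le_hammingNorm_add_of_dual`), and the mathematical content of
Thm. 23 is proved there too (`OnePointAGCodesDecoding.lean`). This file proves the arithmetic of
p. 25 at `r = 8` on top of it: for ANY family of one-point data `S_i` over `𝔽₆₄` with
`N_i = 7·8^{i+2}` evaluation places and genus `g_i ≤ 8^{i+2}`, the codes
`C_m = S_i.code (N_i/2 + g_i - 1)` have dimension `N_i/2` (`finrank_code_gsDegree`), nonzero dual
words of weight `≥ N_i/3` (`le_hammingNorm_of_dual_code_gsDegree`) and nonzero codewords of weight
`≥ (1/2 - 1/7)N_i` (`le_hammingNorm_of_mem_code_gsDegree`) — Thm. 24's parameters at `r = 8`; hence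
the **reduction theorem** `DecodableDualDistanceCodes.of_onePointData`: Prop. 3 follows from such a
family together with clause (c) for it (polynomial-time bounded-distance decoding of the binary
images from a fraction `1/60` of errors) — i.e. from inputs 1 + 3 exactly — and
`LowDegreeCounterexamples.of_onePointData`. The purely mathematical input 1 is recorded as the named
fact `GarciaStichtenothOnePoint64` (the levels of the tower over `𝔽₆₄` as one-point data with `N_i`
evaluation places and `≤ 8^{i+2}` gaps); it yields Thm. 24's dimension and both distance bounds
(`exists_codes_of_garciaStichtenothOnePoint64`, the hypotheses (a)–(b) of
`DecodableDualDistanceCodes.of_codes64`) and is itself reduced, in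
`LowDegreeCounterexamplesCodes64FF.lean` (`GarciaStichtenothOnePoint64.of_card_ratPlaces`, through
the bridge `Literature/NumberTheory/DiophantineGeometry/FunctionFieldOnePointData.lean`), to the
existence of algebraic function fields over `𝔽₆₄` of genus `≤ 8^{i+2}` with `≥ 7·8^{i+2} + 1`
rational places.

**What remains unformalised, and its size.** (i) The tower itself ([GS96] = [Stichtenoth 2009,
§7.4] as in input 1): wildly ramified Artin–Schreier steps, the different of weakly ramified
composita (Prop. 7.4.13, Hilbert's Different Formula, Thm. 3.8.7) and the Hurwitz genus formula in
the wild case — none of which the tree has yet (it has Riemann–Roch, the Weierstrass gap theorem, the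
tame Riemann–Hurwitz formula and Hilbert's ramification theory); a theory-sized (XL) target whose
landing discharges `GarciaStichtenothOnePoint64`. (ii) Clause (c): a single polynomial-time machine
along all block lengths needs polynomial-time computable bases of `L(ℓP_∞^{(m)})` with their
evaluations — the content of [SAK+01] — followed by the linear algebra of Thm. 23 and the
symbol-wise reading of Lemma 26 at machine level (`Literature.Computability.Complexity.CodeFP`,
`CodeFPFinite.lean`, `Literature/LinearAlgebra/Matrix/ListKernel.lean` are the tree's tools for the
generic part); [SAK+01] on top of (i) is a second theory-sized target. Accordingly no named fact
bundles (i) + (ii), nor (i) + (ii) + Lemma 22: earlier versions carried such bundles —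
`GSDecodableOnePoint64` ("one-point data of genus `≤ 8^{i+2}` whose rate-`1/2` codes have binary
images decodable in `P`", i.e. Thm. 24 at `r = 8` minus Lemma 22) in this file, and
`GuruswamiCodes64` (Thm. 24 at `r = 8` with the binary-image decoder, i.e. Prop. 3 minus
Lemmas 25–26) in `LowDegreeCounterexamplesCodes64.lean` —, neither a published statement distinct in
content from the parent; both were merged back (D-0026 reviews, 2026-08-15) into the hypotheses of
`DecodableDualDistanceCodes.of_onePointData` / `DecodableDualDistanceCodes.of_codes64`, so that the
open leaf of the chain `LowDegreeCounterexamples ← DecodableDualDistanceCodes` is Prop. 3 = Shpilka's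
Thm. 4 itself, with `GarciaStichtenothOnePoint64` its purely mathematical input.

## References

* A. Shpilka, *Constructions of low-degree and error-correcting ε-biased generators*, comput.
  complexity 18 (2009) 495–525, doi:10.1007/s00037-009-0281-5; Appendix A by V. Guruswami:
  Lemma 22, Thm. 23 (p. 24), Thm. 24 and its proof (p. 25), Lemmas 25–26 (p. 26). Held.
* H. Stichtenoth, *Algebraic Function Fields and Codes*, 2nd ed., GTM 254, Springer 2009:
  Def. 1.6.7, Thm. 1.6.8 (Weierstrass gap theorem), Thm. 2.2.2, Cor. 2.2.3, Thm. 2.2.7–2.2.8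
  (AG codes and their duals), Thm. 3.4.13 (Hurwitz genus formula), Thm. 3.8.7 (Hilbert's different
  formula), §7.4 (the Garcia–Stichtenoth tower: Def. 7.4.1, Lemma 7.4.3–7.4.6, Thm. 7.4.7,
  Remark 7.4.9–7.4.10, Prop. 7.4.13). Held.
* [GS96] A. Garcia, H. Stichtenoth, *On the asymptotic behaviour of some towers of function fields
  over finite fields*, J. Number Theory 61 (1996) 248–273 — cited through the two sources above.
* [SAK+01] K. W. Shum, I. Aleshnikov, P. V. Kumar, H. Stichtenoth, V. Deolalikar, *A low-complexity
  algorithm for the construction of algebraic-geometric codes better than the Gilbert–Varshamov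
  bound*, IEEE Trans. Inform. Theory 47 (2001) 2225–2241 — cited through Shpilka 2009, App. A.
-/

noncomputable section

namespace Literature.Barriers.PneNP

open Matrix Literature.InformationTheory.Coding

/-! ### The named fact: the Garcia–Stichtenoth tower over `𝔽₆₄` as one-point data -/

/-- **The Garcia–Stichtenoth tower over `𝔽₆₄` as one-point data (the purely mathematical input of
Thm. 24 at `r = 8`).** Printed ([Shpilka 2009, App. A, p. 25], after [GS96]): "For every positive
integer `m`, [Garcia–Stichtenoth] construct a function field `F_m/𝔽_{r²}(X₀)` with at least
`n_m + 1 = (r² - r)r^m + 1` rational places, including a fully ramified place `P_∞^{(m)}` ... that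
can serve the role of `Q` to define the algebraic-geometric code, with the remaining `n_m` rational
places serving as evaluation points `P_1, …, P_{n_m}` of the code. The genus of `F_m` is at most
`r^{m+1}`." In [Stichtenoth 2009, §7.4] `F_m` is the level `G_m = 𝔽_{ℓ²}(x₀, …, x_m)`, `ℓ = r`, of
the tower of Def. 7.4.1: the pole of `x₀` is rational and totally ramified in `G_m/G_0` and
`[G_m : G_0] = ℓ^m` (Lemma 7.4.3), the `ℓ² - ℓ` rational places `x₀ = α`, `α ∈ 𝔽_{ℓ²} ∖ 𝔽_ℓ`, of
`G_0` split completely in `G_m` (Lemma 7.4.4) — whence `≥ (ℓ² - ℓ)ℓ^m + 1` rational places —, and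
every ramified place of `G_0` is one of the `ℓ + 1` rational places over `𝔽_ℓ ∪ {∞}` with different
exponents `d(Q|P) = 2e(Q|P) - 2` above it (Lemma 7.4.5–7.4.6), so that the Hurwitz genus formula
(Thm. 3.4.13, `g(G_0) = 0`) gives `2g(G_m) - 2 ≤ -2ℓ^m + (ℓ + 1)(2ℓ^m - 2)`, i.e.
`g(G_m) ≤ ℓ^{m+1} - ℓ ≤ r^{m+1}` (the exact genus is not computed there, Remark 7.4.10). Vendored at
`r = 8`, `m = i + 1`, in the language of `OnePointData` (which packages, for a rational place
`Q = P_∞` and `N` further rational places, exactly what the Weierstrass gap theorem [Stichtenoth 2009,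
Thm. 1.6.8] and the degree of a principal divisor provide; the bridge from the tree's function
fields is `Literature.NumberTheory.DiophantineGeometry.AlgFunctionField.onePointData`, and
`GarciaStichtenothOnePoint64.of_card_ratPlaces` in `LowDegreeCounterexamplesCodes64FF.lean` reduces
this fact to function fields over `𝔽₆₄` of genus `≤ 8^{i+2}` with `≥ 7·8^{i+2} + 1` rational
places): for every `i` there is one-point data over `𝔽₆₄` with `N_i = 7·8^{i+2}` evaluation places
and at most `8^{i+2}` gaps. It yields Thm. 24's dimension and both distance bounds at `r = 8`
(`exists_codes_of_garciaStichtenothOnePoint64`: the hypotheses (a)–(b) of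
`DecodableDualDistanceCodes.of_codes64`) but not the decoder. Not proved here: the tower
(wild ramification, differents of Artin–Schreier composita, the Hurwitz genus formula in the wild
case) is not formalised in the tree. Users take `(h : GarciaStichtenothOnePoint64)`.
[cite: Shpilka2009, App. A, proof of Thm. 24 (p. 25)] -/
def GarciaStichtenothOnePoint64 : Prop :=
  ∀ i : ℕ, ∃ (R : Type) (_ : CommRing R) (_ : Algebra F64 R)
    (S : OnePointData F64 R (Fin (agLength i))), S.genus ≤ 8 ^ (i + 2)

/-! ### The arithmetic of the proof of Thm. 24 at `r = 8` -/

/-- `N_i = 7 · 8^{i+2}` is even: `N_i / 2 · 2 = N_i`. [folklore] -/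
theorem agLength_div_two_mul_two (i : ℕ) : agLength i / 2 * 2 = agLength i := by
  have h : agLength i = 2 * (7 * 4 * 8 ^ (i + 1)) := by
    simp only [agLength, pow_succ]
    ring
  omega

section Parameters

variable {R : Type*} [CommRing R] [Algebra F64 R] {i : ℕ} (S : OnePointData F64 R (Fin (agLength i)))

/-- **Dimension** (p. 25: "the code `C_m = C(D, α_m P_∞)` has dimension `n_m/2`" for
`α_m = n_m/2 + g - 1`), from Lemma 22: `k = α - g + 1` since `2g - 2 < α < n` (`g ≤ n/7`).
[cite: Shpilka2009, App. A, proof of Thm. 24 (p. 25)] -/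
theorem finrank_code_gsDegree (hg : S.genus ≤ 8 ^ (i + 2)) :
    Module.finrank F64 (S.code (agLength i / 2 + S.genus - 1)) = agLength i / 2 := by
  have h2 := agLength_div_two_mul_two i
  have h7 : agLength i = 7 * 8 ^ (i + 2) := rfl
  have hm : 1 ≤ 8 ^ (i + 2) := Nat.one_le_pow _ _ (by norm_num)
  have h := S.finrank_code_add_genus (a := agLength i / 2 + S.genus - 1) (by omega)
    (by rw [Fintype.card_fin]; omega)
  omega

/-- **Dual distance** (p. 25: "the dual of the code has distance at least
`α - (2g - 2) > n_m/2 - g ≥ n_m(1/2 - 1/(r-1)) ≥ n_m/3`"), from Lemma 22's dual bound: every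
nonzero word orthogonal to `C_m` has weight `≥ N_i/2 - g + 1 ≥ N_i/3`.
[cite: Shpilka2009, App. A, proof of Thm. 24 (p. 25)] -/
theorem le_hammingNorm_of_dual_code_gsDegree (hg : S.genus ≤ 8 ^ (i + 2))
    (y : Fin (agLength i) → F64) (hy : ∀ c ∈ S.code (agLength i / 2 + S.genus - 1), c ⬝ᵥ y = 0)
    (hy0 : y ≠ 0) : (agLength i : ℝ) / 3 ≤ hammingNorm y := by
  have h2 := agLength_div_two_mul_two i
  have h7 : agLength i = 7 * 8 ^ (i + 2) := rfl
  have h := S.add_two_le_hammingNorm_add_of_dual hy hy0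
  have hnat : agLength i ≤ 3 * hammingNorm y := by omega
  have hreal : (agLength i : ℝ) ≤ 3 * hammingNorm y := by exact_mod_cast hnat
  linarith

/-- **Distance** (p. 25: "relative distance at least `(n_m - α_m)/n_m > 1/2 - g/n_m ≥
1/2 - 1/(r-1)`"), from Lemma 22's designed distance `d ≥ n - α`: every nonzero codeword of `C_m`
has weight `≥ N_i/2 - g + 1 ≥ (1/2 - 1/7) N_i`.
[cite: Shpilka2009, App. A, proof of Thm. 24 (p. 25)] -/
theorem le_hammingNorm_of_mem_code_gsDegree (hg : S.genus ≤ 8 ^ (i + 2))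
    (c : Fin (agLength i) → F64) (hc : c ∈ S.code (agLength i / 2 + S.genus - 1)) (hc0 : c ≠ 0) :
    (1 / 2 - 1 / 7 : ℝ) * agLength i ≤ hammingNorm c := by
  have h2 := agLength_div_two_mul_two i
  have h7 : agLength i = 7 * 8 ^ (i + 2) := rfl
  have h := S.card_le_add_hammingNorm hc hc0
  rw [Fintype.card_fin] at h
  have hnat : 5 * agLength i ≤ 14 * hammingNorm c := by omega
  have hreal : (5 * agLength i : ℝ) ≤ 14 * hammingNorm c := by exact_mod_cast hnat
  linarith

end Parameters

/-! ### Assembly: Thm. 24 at `r = 8` from inputs 1 + 3 -/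

/-- **Prop. 3 from Garcia–Stichtenoth-type one-point data with a decoder** (Thm. 24 at `r = 8`
with Lemma 22 proved, then Lemmas 25–26; the printed proof, p. 25–26, from its inputs [GS96] and
[SAK+01] + Thm. 23): given, for every `i`, one-point data `S_i` over `𝔽₆₄` with `N_i = 7·8^{i+2}`
evaluation places and genus `g_i ≤ 8^{i+2}` (input 1: the levels `F_m`, `m = i + 1`, of the tower
with `Q = P_∞^{(m)}`), such that the bounded-distance problem of the binary images of the codes
`C_m = S_i.code (N_i/2 + g_i - 1)` at every rational relative radius `0 < θ ≤ 1/60` is in `P`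
(input 3: "Theorem 23 implies an efficient unique decoding algorithm for the code `C_m` that can
correct `⌊n_m/4⌋ - g ≥ n_m/4 - n_m/(r-1) - 1` errors. For `r ≥ 8`, this exceeds a fraction `1/10`
of errors", and Lemma 26: a fraction `1/60` for the binary image), take `D_i = C_m`: dual weights
`≥ N_i/3` and weights `≥ (1/2 - 1/7)N_i` by the lemmas above, clause (c) verbatim, and conclude by
`DecodableDualDistanceCodes.of_codes64`. The `ℕ`-subtraction in `N_i/2 + g_i - 1` is harmless
(`N_i/2 ≥ 224`). [cite: Shpilka2009, App. A, Thm. 24 and its proof (p. 25), Lemmas 25–26 (p. 26)] -/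
theorem DecodableDualDistanceCodes.of_onePointData (R : ℕ → Type) [∀ i, CommRing (R i)]
    [∀ i, Algebra F64 (R i)] (S : ∀ i, OnePointData F64 (R i) (Fin (agLength i)))
    (hg : ∀ i, (S i).genus ≤ 8 ^ (i + 2))
    (hP : ∀ θ : ℚ, 0 < θ → θ ≤ 1 / 60 →
      bddLanguage (fun i => binaryImage i ((S i).code (agLength i / 2 + (S i).genus - 1))) θ ∈
        Literature.Computability.Complexity.Classes.P) :
    DecodableDualDistanceCodes :=
  DecodableDualDistanceCodes.of_codes64 (fun i => (S i).code (agLength i / 2 + (S i).genus - 1))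
    (fun i y hy hy0 => le_hammingNorm_of_dual_code_gsDegree (S i) (hg i) y hy hy0)
    (fun i c hc hc0 => le_hammingNorm_of_mem_code_gsDegree (S i) (hg i) c hc hc0) hP

/-- Hence the whole chain from the tower data with its decoder: `LowDegreeCounterexamples`
(Holmgren–Wein 2021, Thm. 2, with everything but the tower and the machine-level decoder
formalised). [cite: HolmgrenWein2021, Thm. 2 and Prop. 3 (arXiv pp. 6–7)] -/
theorem LowDegreeCounterexamples.of_onePointData (R : ℕ → Type) [∀ i, CommRing (R i)]
    [∀ i, Algebra F64 (R i)] (S : ∀ i, OnePointData F64 (R i) (Fin (agLength i)))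
    (hg : ∀ i, (S i).genus ≤ 8 ^ (i + 2))
    (hP : ∀ θ : ℚ, 0 < θ → θ ≤ 1 / 60 →
      bddLanguage (fun i => binaryImage i ((S i).code (agLength i / 2 + (S i).genus - 1))) θ ∈
        Literature.Computability.Complexity.Classes.P) :
    LowDegreeCounterexamples :=
  LowDegreeCounterexamples.of_codes (DecodableDualDistanceCodes.of_onePointData R S hg hP)

/-- **Thm. 24's combinatorial clauses at `r = 8` from the tower alone**: the Garcia–Stichtenoth
data over `𝔽₆₄` give `𝔽₆₄`-linear codes of length `N_i = 7·8^{i+2}` and dimension `N_i/2` whose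
nonzero dual words have weight `≥ N_i/3` and whose nonzero codewords have weight
`≥ (1/2 - 1/7)N_i` — i.e. rate-`1/2` codes on the Tsfasman–Vlăduţ–Zink line `R + δ ≥ 1 - 1/7`
(beyond the Gilbert–Varshamov bound at `q = 64`), which is why no counting argument can replace
the tower here. [cite: Shpilka2009, App. A, Thm. 24 (p. 25)] -/
theorem exists_codes_of_garciaStichtenothOnePoint64 (h : GarciaStichtenothOnePoint64) :
    ∃ D : ∀ i : ℕ, Submodule F64 (Fin (agLength i) → F64),
      (∀ i, Module.finrank F64 (D i) = agLength i / 2) ∧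
      (∀ i, ∀ y : Fin (agLength i) → F64, (∀ d ∈ D i, d ⬝ᵥ y = 0) → y ≠ 0 →
        (agLength i : ℝ) / 3 ≤ hammingNorm y) ∧
      (∀ i, ∀ d ∈ D i, d ≠ 0 → (1 / 2 - 1 / 7 : ℝ) * agLength i ≤ hammingNorm d) := by
  choose R _ _ S hg using h
  exact ⟨fun i => (S i).code (agLength i / 2 + (S i).genus - 1),
    fun i => finrank_code_gsDegree (S i) (hg i),
    fun i y hy hy0 => le_hammingNorm_of_dual_code_gsDegree (S i) (hg i) y hy hy0,
    fun i c hc hc0 => le_hammingNorm_of_mem_code_gsDegree (S i) (hg i) c hc hc0⟩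

/-- The data of `GarciaStichtenothOnePoint64`, chosen as a family along `i` (the form in which
`DecodableDualDistanceCodes.of_onePointData` consumes input 1; what it lacks towards Prop. 3 is
exactly the decoder hypothesis `hP` for THIS family). [folklore] -/
theorem GarciaStichtenothOnePoint64.exists_family (h : GarciaStichtenothOnePoint64) :
    ∃ (R : ℕ → Type) (_ : ∀ i, CommRing (R i)) (_ : ∀ i, Algebra F64 (R i))
      (S : ∀ i, OnePointData F64 (R i) (Fin (agLength i))), ∀ i, (S i).genus ≤ 8 ^ (i + 2) := by
  choose R _ _ S hg using h
  exact ⟨R, ‹_›, ‹_›, S, hg⟩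

end Literature.Barriers.PneNP

end
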